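import Summits.AtomisticToContinuum.BoseEinsteinCondensation.Theorems.BECSwapNoCatastropheTorusHalfSwapOverlapCruxOfChord
import HarnessLib

/-!
# Route BECSwapNoCatastrophe — the two-copy torus vocabulary (`TwoCopyTorus`): ranks 2–3 and their glue, folded

Route `BECSwapNoCatastrophe` (sub-problem `BoseEinsteinCondensation`); requested by the route's thesis ("Desirable later:
(a) a problem-side vocabulary `TwoCopyTorus` (two-copy periodic admissible class, swap map F, s-coupled form E2(s)) under
…/BoseEinsteinCondensation/Theorems to shorten ranks 2–3 and their glue") and written by the line lead of crux
`TorusHalfSwapOverlap` (stmt-AtomisticToContinuum-14393, line `birth`, lead c3, 2026-08-17).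

Two copies of `N = n + 1` bosons on the torus `(ℝ³/Lℤ³)`, configurations `(X, Y)`, tagged particles `a = X 0`, `b = Y 0`:
the two-copy cell `cell2`, the one-pair swap `swapF`, the total kinetic density `kinetic2`, the half-swapped weight and form
`halfSwapWeight` / `E2half` (= the inlined `E2` of rank 2 `TorusHalfSwapOverlap`, `torusHalfSwapOverlap_iff : … := Iff.rfl`),
the uncoupled form `E2zero` (`H ⊕ H`), the swap-path form `E2path s` (= the inlined `E2` of rank 3 `TorusSwapPathRigidity`,
`torusSwapPathRigidity_iff : … := Iff.rfl`), periodicity `IsPeriodic2`, swap symmetry `IsSwapSymmetric`, the absolute and the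
swap-symmetric admissible classes `Adm0` / `AdmSym`; then the STATEMENTS of the line `birth` as named propositions —
`MidpointChordAt v` (the pure two-copy chord-overlap claim at `v`), `BoundedChord`, `SingularChord` (its bounded /
unbounded-`v` halves), `SwapInvariance`, `SymmetricInfimumAll`, `ProductUpper`, `ProductLower` — and the FOLDED forms of what
is landed in the tree (each by `Iff.rfl`/definitional unfolding of the corresponding `…Cruxes.TorusHalfSwapOverlap.Birth.stub_*`
theorem): `swapInvariance`, `symmetricInfimumAll`, `productUpper`, `productLower`, `boundedChord_of_pathRigidity`,
`midpointChordAt_of`, and the reduction of the crux `torusHalfSwapOverlap_of_pathRigidity_of_singularChord :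
TorusSwapPathRigidity → SingularChord → TorusHalfSwapOverlap`.

What is OPEN (no theorem here claims it): `BoundedChord` beyond its reduction to rank 3, `SingularChord` (hard cores /
unbounded `v`), and the route items themselves. Design: plain `def`s over `Literature…BoseGas` vocabulary, bodies
byte-identical to the route decls' inlined `let`s so that every identification is `Iff.rfl`.
-/

noncomputable section

open MeasureTheory Filter
open scoped ENNReal NNReal BigOperators ComplexConjugate

namespace Summit.AtomisticToContinuum.BoseEinsteinCondensation.TwoCopyTorus

open Literature.MathematicalPhysics.QuantumManyBody.BoseGas
open Summit.AtomisticToContinuum.BoseEinsteinCondensation.Theses.BECSwapNoCatastrophe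
  (TorusHalfSwapOverlap TorusSwapPathRigidity)
open Summit.AtomisticToContinuum.BoseEinsteinCondensation.Cruxes.TorusHalfSwapOverlap.Birth
  (stub_chordOfPath stub_swapInvariance stub_symmetricInfimum stub_productUpper stub_productLower
    torusHalfSwapOverlap_of_pathRigidity_of_singularChord)

/-! ## §1 Vocabulary: the two-copy torus (verbatim the crux's inlined `let`s) -/

/-- Two-copy configurations `(X, Y) ∈ (ℝ³)^{n+1} × (ℝ³)^{n+1}`; tagged particles `a = X 0`, `b = Y 0`. -/
abbrev Config2 (n : ℕ) : Type := Config (n + 1) × Config (n + 1)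

/-- The two-copy fundamental cell `[0,L)^{3(n+1)} × [0,L)^{3(n+1)}`. -/
def cell2 (n : ℕ) (L : ℝ) : Set (Config2 n) :=
  (cellN (n + 1) L) ×ˢ (cellN (n + 1) L)

/-- The one-pair swap `F (X, Y) = (y₀ :: X̂, x₀ :: Ŷ)` exchanging the tagged particles of the two copies. -/
def swapF (n : ℕ) (Z : Config2 n) : Config2 n :=
  (Matrix.vecCons (Z.2 0) (Fin.tail Z.1), Matrix.vecCons (Z.1 0) (Fin.tail Z.2))

/-- Total kinetic density of both copies. -/
def kinetic2 (n : ℕ) (Θ : Config2 n → ℂ) (Z : Config2 n) : ℝ≥0∞ :=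
  kineticDensity (fun X => Θ (X, Z.2)) Z.1 + kineticDensity (fun Y => Θ (Z.1, Y)) Z.2

/-- The HALF-SWAPPED interaction weight (`s = ½`): bath–bath interactions inside each copy, and each
tagged particle coupled at half strength to both baths (`½ · ⊤ = ⊤`). -/
def halfSwapWeight (v : ℝ → ℝ≥0∞) (n : ℕ) (L : ℝ) (Z : Config2 n) : ℝ≥0∞ :=
  periodicInteraction v L (Fin.tail Z.1) + periodicInteraction v L (Fin.tail Z.2) +
    ∑ j : Fin n, (2 : ENNReal)⁻¹ * (periodizedPotential v L (Z.1 0 - Z.1 j.succ) +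
      periodizedPotential v L (Z.2 0 - Z.2 j.succ) + periodizedPotential v L (Z.2 0 - Z.1 j.succ) +
      periodizedPotential v L (Z.1 0 - Z.2 j.succ))

/-- The half-swapped two-copy periodic quadratic form `E2(½)(Θ) = ∫_{cell²} |∇_X Θ|² + |∇_Y Θ|² + w_½ |Θ|²`
(verbatim the crux's `E2`; see `E2half_eq`). -/
def E2half (v : ℝ → ℝ≥0∞) (n : ℕ) (L : ℝ) (Θ : Config2 n → ℂ) : ℝ≥0∞ :=
  ∫⁻ Z in cell2 n L, (kineticDensity (fun X => Θ (X, Z.2)) Z.1 + kineticDensity (fun Y => Θ (Z.1, Y)) Z.2 +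
    (periodicInteraction v L (Fin.tail Z.1) + periodicInteraction v L (Fin.tail Z.2) +
      ∑ j : Fin n, (2 : ENNReal)⁻¹ * (periodizedPotential v L (Z.1 0 - Z.1 j.succ) +
        periodizedPotential v L (Z.2 0 - Z.2 j.succ) + periodizedPotential v L (Z.2 0 - Z.1 j.succ) +
        periodizedPotential v L (Z.1 0 - Z.2 j.succ))) * (‖Θ Z‖₊ : ENNReal) ^ 2)

/-- `E2(½)` is "kinetic density of both copies + half-swapped weight × |Θ|²" (by `rfl`). -/
theorem E2half_eq (v : ℝ → ℝ≥0∞) (n : ℕ) (L : ℝ) (Θ : Config2 n → ℂ) :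
    E2half v n L Θ = ∫⁻ Z in cell2 n L, kinetic2 n Θ Z + halfSwapWeight v n L Z * (‖Θ Z‖₊ : ENNReal) ^ 2 :=
  rfl

/-- The UNCOUPLED two-copy periodic quadratic form `E2(0)(Θ) = ∫_{cell²} |∇_X Θ|² + |∇_Y Θ|² +
(∑_{i<j} v^per(xᵢ-xⱼ) + ∑_{i<j} v^per(yᵢ-yⱼ)) |Θ|²` (the form of `H ⊕ H = H ⊗ 1 + 1 ⊗ H`). -/
def E2zero (v : ℝ → ℝ≥0∞) (n : ℕ) (L : ℝ) (Θ : Config2 n → ℂ) : ℝ≥0∞ :=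
  ∫⁻ Z in cell2 n L, kinetic2 n Θ Z + (periodicInteraction v L Z.1 + periodicInteraction v L Z.2) * (‖Θ Z‖₊ : ENNReal) ^ 2

/-- The route's swap-path form `E2(s)` (verbatim the `E2` of rank 3 `TorusSwapPathRigidity`): bath–bath
interactions plus `(1−s)[v^per(a−xⱼ) + v^per(b−yⱼ)] + s[v^per(b−xⱼ) + v^per(a−yⱼ)]`. -/
def E2path (v : ℝ → ℝ≥0∞) (n : ℕ) (L : ℝ) (s : ℝ) (Θ : Config2 n → ℂ) : ℝ≥0∞ :=
  ∫⁻ Z in cell2 n L, (kineticDensity (fun X => Θ (X, Z.2)) Z.1 + kineticDensity (fun Y => Θ (Z.1, Y)) Z.2 +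
    (periodicInteraction v L (Fin.tail Z.1) + periodicInteraction v L (Fin.tail Z.2) +
      ∑ j : Fin n, (ENNReal.ofReal (1 - s) * (periodizedPotential v L (Z.1 0 - Z.1 j.succ) +
        periodizedPotential v L (Z.2 0 - Z.2 j.succ)) + ENNReal.ofReal s *
          (periodizedPotential v L (Z.2 0 - Z.1 j.succ) + periodizedPotential v L (Z.1 0 - Z.2 j.succ)))) *
      (‖Θ Z‖₊ : ENNReal) ^ 2)

/-- `Lℤ³`-periodicity in every particle coordinate of both copies (on generators). -/
def IsPeriodic2 (n : ℕ) (L : ℝ) (Θ : Config2 n → ℂ) : Prop :=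
  ∀ (Z : Config2 n) (i : Fin (n + 1)) (k : Fin 3),
    Θ (Z.1 + Pi.single i (EuclideanSpace.single k L), Z.2) = Θ Z ∧
      Θ (Z.1, Z.2 + Pi.single i (EuclideanSpace.single k L)) = Θ Z

/-- Swap symmetry `Θ ∘ F = Θ`, `F : a = X 0 ↔ b = Y 0`. -/
def IsSwapSymmetric (n : ℕ) (Θ : Config2 n → ℂ) : Prop :=
  ∀ X Y : Config (n + 1), Θ (Matrix.vecCons (Y 0) (Fin.tail X), Matrix.vecCons (X 0) (Fin.tail Y)) = Θ (X, Y)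

/-- ABSOLUTE admissible class on `cell²`: `C¹`, periodic in both copies, normalised (no symmetry). -/
def Adm0 (n : ℕ) (L : ℝ) (Θ : Config2 n → ℂ) : Prop :=
  ContDiff ℝ 1 Θ ∧ IsPeriodic2 n L Θ ∧ ∫⁻ Z in cell2 n L, (‖Θ Z‖₊ : ENNReal) ^ 2 = 1

/-- The crux's admissible class: `Adm0` plus swap symmetry (conjuncts in the crux's order). -/
def AdmSym (n : ℕ) (L : ℝ) (Θ : Config2 n → ℂ) : Prop :=
  ContDiff ℝ 1 Θ ∧ IsPeriodic2 n L Θ ∧ IsSwapSymmetric n Θ ∧ ∫⁻ Z in cell2 n L, (‖Θ Z‖₊ : ENNReal) ^ 2 = 1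

/-- A swap-symmetric admissible function is absolutely admissible (forget the symmetry). [folklore] -/
theorem AdmSym.adm0 {n : ℕ} {L : ℝ} {Θ : Config2 n → ℂ} (h : AdmSym n L Θ) : Adm0 n L Θ :=
  ⟨h.1, h.2.1, h.2.2.2⟩

/-- The crux in this vocabulary — definitionally (`Iff.rfl`): the route decl's `let`s are exactly
`cell2`, `E2half`, `AdmSym` at `L = sideLength ρ (n+1)`. -/
theorem torusHalfSwapOverlap_iff :
    TorusHalfSwapOverlap ↔
      ∀ v : ℝ → ℝ≥0∞, IsRepulsiveFiniteRange v → ∃ ρ₀ : ℝ, 0 < ρ₀ ∧ ∀ ρ : ℝ, 0 < ρ → ρ < ρ₀ →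
        ∃ η : ℝ, 0 < η ∧ ∀ᶠ n : ℕ in atTop, ∃ δ : ℝ≥0∞, 0 < δ ∧
          ∀ Ψ : PeriodicTrialState (n + 1) (sideLength ρ (n + 1)),
            periodicEnergy v Ψ ≤ periodicGroundStateEnergy v (n + 1) (sideLength ρ (n + 1)) + δ →
            ∀ Θ : Config2 n → ℂ, AdmSym n (sideLength ρ (n + 1)) Θ →
              E2half v n (sideLength ρ (n + 1)) Θ ≤
                (⨅ (Θ' : Config2 n → ℂ) (_ : AdmSym n (sideLength ρ (n + 1)) Θ'),
                  E2half v n (sideLength ρ (n + 1)) Θ') + δ →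
              ENNReal.ofReal (1 / 2 + η) ≤
                (‖∫ Z in cell2 n (sideLength ρ (n + 1)), (starRingEnd ℂ) (Θ Z) * (Ψ.ψ Z.1 * Ψ.ψ Z.2)‖₊ :
                  ENNReal) ^ 2 :=
  Iff.rfl

/-- Rank 3 in this vocabulary — definitionally (`Iff.rfl`): its `let`s are `cell2`, `E2path`, `Adm0`. -/
theorem torusSwapPathRigidity_iff :
    TorusSwapPathRigidity ↔
      ∀ v : ℝ → ℝ≥0∞, IsRepulsiveFiniteRange v → (∃ M : NNReal, ∀ r, v r ≤ M) → ∀ ε : ℝ, 0 < ε →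
        ∃ ρ₀ : ℝ, 0 < ρ₀ ∧ ∀ ρ : ℝ, 0 < ρ → ρ < ρ₀ → ∀ᶠ n : ℕ in atTop,
          ∀ s : ℝ, 0 ≤ s → s ≤ 1 → ∀ s' : ℝ, 0 ≤ s' → s' ≤ 1 → ∀ τ : ℝ, 0 < τ → ∃ δ : ℝ≥0∞, 0 < δ ∧
            ∀ Θ Θ' : Config2 n → ℂ, Adm0 n (sideLength ρ (n + 1)) Θ → Adm0 n (sideLength ρ (n + 1)) Θ' →
              E2path v n (sideLength ρ (n + 1)) s Θ ≤
                (⨅ (Θ'' : Config2 n → ℂ) (_ : Adm0 n (sideLength ρ (n + 1)) Θ''),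
                  E2path v n (sideLength ρ (n + 1)) s Θ'') + δ →
              E2path v n (sideLength ρ (n + 1)) s' Θ' ≤
                (⨅ (Θ'' : Config2 n → ℂ) (_ : Adm0 n (sideLength ρ (n + 1)) Θ''),
                  E2path v n (sideLength ρ (n + 1)) s' Θ'') + δ →
              ENNReal.ofReal (1 - ε * (s - s') ^ 2 - τ) ≤
                (‖∫ Z in cell2 n (sideLength ρ (n + 1)), (starRingEnd ℂ) (Θ Z) * Θ' Z‖₊ : ENNReal) ^ 2 :=
  Iff.rfl

/-! ## §2 The stub statements -/

/-- **The midpoint-chord overlap claim at a fixed potential `v`** (shared body of the chord stubs): there is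
`ρ₀ > 0` such that for `0 < ρ < ρ₀` there is `η > 0` with, for all large `n` and some `δ > 0`: every
absolutely admissible `δ`-near-minimiser `Φ` of the uncoupled two-copy form `E2(0)` and every absolutely
admissible `δ`-near-minimiser `Θ` of the half-swapped form `E2(½)` on the torus of side `((n+1)/ρ)^{1/3}`
satisfy `|⟨Θ, Φ⟩_{cell²}|² ≥ ½ + η`. Ground-state reading (Perron–Frobenius at fixed `n`):
`|⟨Φ(½), Ψ₀ ⊗ Ψ₀⟩|² ≥ ½ + η` UNIFORMLY IN `n` — the integrated no-orthogonality-catastrophe claim for the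
chord `s = 0 → ½` of the swap path, with the product structure and the swap symmetry of the crux factored
out (they return through the fixed-`n` stubs). -/
def MidpointChordAt (v : ℝ → ℝ≥0∞) : Prop :=
  ∃ ρ₀ : ℝ, 0 < ρ₀ ∧ ∀ ρ : ℝ, 0 < ρ → ρ < ρ₀ →
    ∃ η : ℝ, 0 < η ∧ ∀ᶠ n : ℕ in atTop, ∃ δ : ℝ≥0∞, 0 < δ ∧
      ∀ Φ Θ : Config2 n → ℂ,
        Adm0 n (sideLength ρ (n + 1)) Φ →
        E2zero v n (sideLength ρ (n + 1)) Φ ≤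
          (⨅ (Θ' : Config2 n → ℂ) (_ : Adm0 n (sideLength ρ (n + 1)) Θ'), E2zero v n (sideLength ρ (n + 1)) Θ') + δ →
        Adm0 n (sideLength ρ (n + 1)) Θ →
        E2half v n (sideLength ρ (n + 1)) Θ ≤
          (⨅ (Θ' : Config2 n → ℂ) (_ : Adm0 n (sideLength ρ (n + 1)) Θ'), E2half v n (sideLength ρ (n + 1)) Θ') + δ →
        ENNReal.ofReal (1 / 2 + η) ≤
          (‖∫ Z in cell2 n (sideLength ρ (n + 1)), (starRingEnd ℂ) (Θ Z) * Φ Z‖₊ : ENNReal) ^ 2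

/-- **Chord claim for REGULAR potentials (XL / open-problem as a statement; reached here ONLY through
`stub_chordOfPath` from rank 3).** No orthogonality catastrophe across the half-swap chord, bounded
finite-range `v`: `(0, ½)` chord of `TorusSwapPathRigidity` (same absolute class `Adm0`). -/
def BoundedChord : Prop :=
  ∀ v : ℝ → ℝ≥0∞, IsRepulsiveFiniteRange v → (∃ M : NNReal, ∀ r, v r ≤ M) → MidpointChordAt v

/-- **Stub (M, glue): rank 3 ⇒ the bounded chord.** `TorusSwapPathRigidity → BoundedChord`: with `ε = 1`
take rank 3's `ρ₀`; `η = ⅛`; eventually in `n` use `(s, s′) = (½, 0)`, `τ = ⅛` and its `δ`; the forms agree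
pointwise — `E2path v n L (1/2) = E2half v n L` (`ofReal (1 - 1/2) = ofReal (1/2) = 2⁻¹`, `mul_add`) and
`E2path v n L 0 = E2zero v n L` (`ofReal 1 = 1`, `ofReal 0 * _ = 0`, and `periodicInteraction_succ`:
`∑ⱼ v^per(x₀ − xⱼ₊₁) + periodicInteraction (tail X) = periodicInteraction X`, `Fin.tail = Matrix.vecTail`),
hence so do the `Adm0`-infima — and `1 − 1·(½ − 0)² − ⅛ = ½ + ⅛`. Why it might fail: it cannot (pure
bookkeeping); the weight is carried by rank 3. Leans on: `periodicInteraction_succ`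
(`Literature…PeriodicBoseGasTagged`), `ENNReal.ofReal` arithmetic. -/
def ChordOfPath : Prop :=
  TorusSwapPathRigidity → BoundedChord

/-- **Stub (XL; the load for SINGULAR potentials): the chord overlap for unbounded finite-range `v`** —
hard cores `v = ⊤` on `[0, a]` included, where the path is DEGENERATE (`½ · ⊤ = ⊤`: every `E2(s)`,
`0 < s < 1`, carries the full cross-core exclusion while `E2(0)` does not), so no differential argument
exists and rank 3 does not apply as filed. Expected mechanisms: (i) positivity / Feynman–Kac for the
two-copy torus measure (the half-swapped ground state is a positive reweighting of `Ψ₀ ⊗ Ψ₀` off an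
excluded set of relative volume `O(ρ a³)`); (ii) a core-RADIUS deformation `r_A(s) + r_B(s) ≤ a` keeping
the tagged impurity's scattering length `≤ a`; (iii) Dyson-lemma softening (LSSY2005 Lemma 2.5) to a
bounded nearest-neighbour potential with the same scattering length, then rank 3 for the softened forms
plus a variational comparison back. Why it might fail: an `O(1)` overlap deficit from the UV of the
half-coupled pair surviving `ρ → 0` (midpoint impurity energy `2μ` for hard cores) would break the `½`;
near-minimiser-wise the claim has the strength of torus BEC for hard spheres. NOTE the hypothesis
`¬ ∃ M, ∀ r, v r ≤ M` quantifies over ALL `r : ℝ` (also `r < 0`, never evaluated), so this class also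
contains potentials that are bounded on `[0, ∞)`. Leans on: LSSY2005 Lemma 2.5 (Dyson), Thm 2.4; nothing
in tree. -/
def SingularChord : Prop :=
  ∀ v : ℝ → ℝ≥0∞, IsRepulsiveFiniteRange v → (¬ ∃ M : NNReal, ∀ r, v r ≤ M) → MidpointChordAt v

/-- **Stub (M, fixed `n`): the one-pair swap preserves the absolute class and the half-swapped form.**
For every `v`, `n`, `L` and every `Θ ∈ Adm0`: `Θ ∘ F ∈ Adm0` and `E2(½)(Θ ∘ F) = E2(½)(Θ)`, where
`F (X, Y) = (y₀ :: X̂, x₀ :: Ŷ)` (`swapF`). Why true: `Θ ∘ F` is `C¹` (`F` is a continuous linear map),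
periodic (translating `x₀` in `F Z` translates `y₀`'s slot, etc.), and `∫_{cell²} |Θ ∘ F|² = ∫_{cell²} |Θ|²`
because `F` is a measure-preserving involution of Lebesgue measure mapping `cell²` onto itself (glue
coordinates `e : ((X̂, Ŷ), (x, y)) ↦ (x :: X̂, y :: Ŷ)` of `exists_measurableEquiv_twoCopy`, under which
`F = e ∘ Prod.map id Prod.swap ∘ e⁻¹`); for the form, the half-swapped weight is `F`-invariant termwise
(`a ↔ b` exchanges `v^per(a − xⱼ) ↔ v^per(b − xⱼ)` and `v^per(b − yⱼ) ↔ v^per(a − yⱼ)`, tails fixed) and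
the total kinetic density satisfies `kinetic2 (Θ ∘ F) Z = kinetic2 Θ (F Z)` (chain rule: the partial
derivative of `Θ ∘ F` at `Z` along particle `i` of copy 1, axis `k`, is the partial derivative of `Θ` at
`F Z` along the `F`-image direction — `F` permutes the `6(n+1)` coordinate directions), then change
variables `Z ↦ F Z` on `cell²` (`MeasurePreserving.lintegral_comp_emb`, no measurability of `v` needed).
Leans on: Mathlib `fderiv` chain rule / `ContinuousLinearEquiv`, `MeasurePreserving`, `Measure.prod_restrict`,
`volume_preserving_piFinSuccAbove`; `exists_measurableEquiv_twoCopy` (Theorems, PROVED). -/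
def SwapInvariance : Prop :=
  ∀ v : ℝ → ℝ≥0∞, IsRepulsiveFiniteRange v → ∀ (n : ℕ) (L : ℝ) (Θ : Config2 n → ℂ), Adm0 n L Θ →
    Adm0 n L (fun Z => Θ (swapF n Z)) ∧ E2half v n L (fun Z => Θ (swapF n Z)) = E2half v n L Θ

/-- **"F-symmetric infimum = absolute infimum" for the half-swapped form, at every `n` and `L`.** -/
def SymmetricInfimumAll : Prop :=
  ∀ v : ℝ → ℝ≥0∞, IsRepulsiveFiniteRange v → ∀ (n : ℕ) (L : ℝ),
    (⨅ (Θ' : Config2 n → ℂ) (_ : AdmSym n L Θ'), E2half v n L Θ') =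
      ⨅ (Θ' : Config2 n → ℂ) (_ : Adm0 n L Θ'), E2half v n L Θ'

/-- **Stub (L, fixed `n`, all `v` incl. hard cores): swap invariance ⇒ F-symmetric infimum = absolute
infimum.** `≥` is monotonicity of `iInf` (`AdmSym → Adm0`). `≤`: for `Θ ∈ Adm0` with `q(Θ) < ⊤`
(`q = E2half v n L`) put `g± = Θ ± Θ∘F`; pointwise parallelogram identities for the kinetic density
(`fderiv` is additive; `|a+b|² + |a−b|² = 2|a|² + 2|b|²` in `ℂ`) and for `w|·|²` give
`q(g₊) + q(g₋) = 2q(Θ) + 2q(Θ∘F) = 4q(Θ)` (swap invariance) and `‖g₊‖² + ‖g₋‖² = 4`, so one branch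
`g ≠ 0` has `q(g) ≤ q(Θ)‖g‖²` (if `g₊ = 0` then `g₋ = 2Θ` works with equality, and vice versa).
Branch `g₊`: swap-symmetric, `C¹`, periodic; normalise (`q(c g) = |c|² q(g)`). Branch `g₋`
(antisymmetric, `g₋ ∘ F = −g₋`): replace by `h_ε = √(|g₋|² + ε²) − ε`, which IS swap-symmetric
(`|g₋ ∘ F| = |g₋|`), `C¹` (`contDiff_sqrtReg` with a one-element family), periodic, with
`|∇h_ε|² ≤ |∇g₋|²` (`nnnorm_fderiv_ofReal_sqrtReg_sq_le`) and `h_ε² ≤ |g₋|²`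
(`nnnorm_ofReal_sqrtReg_sq_le`; so `⊤`-weights are respected), hence `q(h_ε) ≤ q(g₋)`, and
`‖h_ε‖² → ‖g₋‖²` (`tendsto_sqrtReg_sq` + dominated convergence, cf. `tendsto_lintegral_nnnorm_sqrtSym_sq`);
so `inf_AdmSym ≤ q(h_ε)/‖h_ε‖² → q(g₋)/‖g₋‖² ≤ q(Θ)`. Near-minimiser form of Perron–Frobenius. Empty
classes (`L ≤ 0`) give `⊤ = ⊤`. Leans on: `Literature…BosonicFloorSymmetrisation` (`sqrtReg` calculus,
PROVED), `Literature…BosonicFloor` (pattern of `periodicGroundStateEnergy_le_lintegral_of_periodic`),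
Mathlib `lintegral` monotonicity / dominated convergence. -/
def SymmetricInfimumOfInvariance : Prop :=
  SwapInvariance → SymmetricInfimumAll

/-- **Stub (M, fixed `n`): the product of a periodic trial state with itself is absolutely admissible and
its uncoupled two-copy energy is at most twice the one-copy energy** (in truth: equal). For every `v`, `n`,
`L` and `Ψ : PeriodicTrialState (n+1) L`: `Ψ ⊗ Ψ ∈ Adm0` (`ContDiff.mul`, `Ψ.periodic`, and
`∫_{cell²} |Ψ(X)|²|Ψ(Y)|² = 1` by `Measure.prod_restrict` + `lintegral_prod_mul` + `Ψ.norm_eq`) and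
`E2(0)(Ψ ⊗ Ψ) ≤ 2 · periodicEnergy v Ψ` (product rule: `fderiv ℝ (fun X => Ψ X * Ψ Y) X = Ψ Y • fderiv ℝ Ψ X`,
so `|∇_X(Ψ⊗Ψ)|²(X,Y) = |Ψ Y|² |∇Ψ|²(X)`; the integrand is
`|Ψ Y|²(|∇Ψ|²(X) + V(X)|Ψ X|²) + |Ψ X|²(|∇Ψ|²(Y) + V(Y)|Ψ Y|²)`; Tonelli twice). Leans on:
`PeriodicTrialState` API, `measurable_kineticDensity`, Mathlib product-measure `lintegral` lemmas. -/
def ProductUpper : Prop :=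
  ∀ v : ℝ → ℝ≥0∞, IsRepulsiveFiniteRange v → ∀ (n : ℕ) (L : ℝ) (Ψ : PeriodicTrialState (n + 1) L),
    Adm0 n L (fun Z => Ψ.ψ Z.1 * Ψ.ψ Z.2) ∧
      E2zero v n L (fun Z => Ψ.ψ Z.1 * Ψ.ψ Z.2) ≤ 2 * periodicEnergy v Ψ

/-- **Stub (M/L, fixed `n`): the uncoupled two-copy form is bounded below by twice the bosonic ground-state
energy on the absolute class.** For every `v`, `n`, `L` and `Θ ∈ Adm0`: `2 E₀^per(n+1, L) ≤ E2(0)(Θ)`.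
Why true: `E2(0)(Θ) ≥ ∫_Y q₁(Θ(·,Y)) dY + ∫_X q₁(Θ(X,·)) dX` (`le_lintegral_add`; Tonelli on
`cellN ×ˢ cellN` via `Measure.prod_restrict` / `lintegral_prod`, measurability of
`Z ↦ kineticDensity (fun X => Θ (X, Z.2)) Z.1 = ∑ ‖fderiv ℝ Θ Z (Pi.single i (e_k), 0)‖²` from continuity of
`fderiv` of a `C¹` map), and for each slice `f = Θ(·, Y)` (`C¹`, periodic, `m = ∫_cell |f|² < ⊤`):
`q₁(f) ≥ E₀^per · m` — the homogeneous form of `periodicGroundStateEnergy_le_lintegral_of_periodic`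
(BosonicFloor.lean: bosonic infimum ≤ form of ANY normalised periodic `C¹` function; rescale `f/√m`,
`kineticDensity (c • f) = |c|² kineticDensity f`; `m = 0` trivial); finally `∫_Y m_Y dY = ∫_{cell²}|Θ|² = 1`.
Leans on: `periodicGroundStateEnergy_le_lintegral_of_periodic` (PROVED), Mathlib Tonelli. -/
def ProductLower : Prop :=
  ∀ v : ℝ → ℝ≥0∞, IsRepulsiveFiniteRange v → ∀ (n : ℕ) (L : ℝ) (Θ : Config2 n → ℂ), Adm0 n L Θ →
    2 * periodicGroundStateEnergy v (n + 1) L ≤ E2zero v n L Θ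

/-- Both regimes together: the chord claim for every repulsive finite-range `v`. -/
theorem midpointChordAt_of (h1a : BoundedChord) (h1b : SingularChord) (v : ℝ → ℝ≥0∞)
    (hv : IsRepulsiveFiniteRange v) : MidpointChordAt v := by
  by_cases hb : ∃ M : NNReal, ∀ r, v r ≤ M
  · exact h1a v hv hb
  · exact h1b v hv hb

/-! ## §3 Folded forms of the landed theorems (definitional read-backs of `…Cruxes.TorusHalfSwapOverlap.Birth.stub_*`) -/

/-- **The one-pair swap preserves the absolute class and the half-swapped form** (folded `stub_swapInvariance`,
Theorems/BECSwapNoCatastropheTorusHalfSwapOverlapSwapInvariance.lean). [folklore] -/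
theorem swapInvariance : SwapInvariance :=
  stub_swapInvariance

/-- **F-symmetric infimum = absolute infimum for `E2(½)`, every `v`, `n`, `L`** (folded `stub_symmetricInfimum` fed with
`swapInvariance`; Theorems/…SymmetricInfimum.lean). [folklore] -/
theorem symmetricInfimumAll : SymmetricInfimumAll :=
  stub_symmetricInfimum stub_swapInvariance

/-- **`Ψ ⊗ Ψ ∈ Adm0` and `E2(0)(Ψ ⊗ Ψ) ≤ 2 · periodicEnergy v Ψ`** (folded `stub_productUpper`; Theorems/…ProductUpper.lean).
[folklore] -/
theorem productUpper : ProductUpper :=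
  stub_productUpper

/-- **`2 E₀^per(n+1, L) ≤ E2(0)(Θ)` on `Adm0`** (folded `stub_productLower`; Theorems/…ProductLower.lean). [folklore] -/
theorem productLower : ProductLower :=
  stub_productLower

/-- **Rank 3 ⇒ the bounded chord** (folded `stub_chordOfPath`; Theorems/…ChordOfPath.lean): `TorusSwapPathRigidity`
(stmt-AtomisticToContinuum-14394) implies `BoundedChord`. [folklore] -/
theorem boundedChord_of_pathRigidity : TorusSwapPathRigidity → BoundedChord :=
  stub_chordOfPath

/-- **The crux from rank 3 and the singular chord** (folded `torusHalfSwapOverlap_of_pathRigidity_of_singularChord`;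
Theorems/…CruxOfChord.lean): `TorusSwapPathRigidity → SingularChord → TorusHalfSwapOverlap`. Both hypotheses are OPEN. [folklore] -/
theorem torusHalfSwapOverlap_of_pathRigidity_of_singularChord (h0 : TorusSwapPathRigidity) (h1b : SingularChord) :
    TorusHalfSwapOverlap :=
  Cruxes.TorusHalfSwapOverlap.Birth.torusHalfSwapOverlap_of_pathRigidity_of_singularChord h0 h1b

/-- **The crux from the two chord halves** (registered sub-goal `stub_cruxOfChords` of stmt-AtomisticToContinuum-14393,
in the folded vocabulary): `BoundedChord → SingularChord → TorusHalfSwapOverlap` (case split via `midpointChordAt_of`,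
then the landed composition node `…Birth.stub_cruxOfChord`). Both hypotheses are OPEN. [folklore] -/
theorem stub_cruxOfChords : BoundedChord → SingularChord → TorusHalfSwapOverlap :=
  fun h1a h1b v hv => Cruxes.TorusHalfSwapOverlap.Birth.stub_cruxOfChord v hv (midpointChordAt_of h1a h1b v hv)

end Summit.AtomisticToContinuum.BoseEinsteinCondensation.TwoCopyTorus

end
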